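import Summits.NavierStokesRegularity.NavierStokesRegularity.Theorems.ExtremiserTransienceNearExtremalTransienceExtremiserLiouvilleConstantCarrier
import Summits.NavierStokesRegularity.NavierStokesRegularity.Theorems.ExtremiserTransienceNearExtremalTransienceExtremiserLiouvilleConstantSpeedKKTTailTools
import HarnessLib

/-!
# Crux `ExtremiserTransience.NearExtremalTransience` (stmt-NavierStokesRegularity-21883), line `extremiser_liouville`,
# stub K1b — THE KKT MULTIPLIER OF A RESIDUE OBJECT HAS NO ATOMS

`--supports stmt-NavierStokesRegularity-21883` (helper).  Author: prover seat `ns-el-k1b` (g6).  g3 built the multiplier `μ` of the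
K1b residue (`…ConstantSpeedMultiplierMeasure`) as a finite measure satisfying
`S·J₁(φ) − κ⋆²M²(W a₁(φ) + Z c₁(φ)) = ∫⟪v, φ⟫dμ` for solenoidal `φ ∈ C_c^∞`.  Testing with g0's constant carrier at scale `L`
centred at `x₀` with plateau value `v(x₀)` (`Ψ_L(x) = Φ_{v(x₀),L}(x − x₀)`, `…ConstantCarrier`: smooth, compactly supported in
`B̄(x₀, L·R_K)`, solenoidal, `‖Ψ_L‖ ≤ M`, `Ψ_L(x₀) = v(x₀)`): the left-hand side is `O(L)` (LOCAL sup bounds of `ω`, `Dω` near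
`x₀` against `‖curl Ψ_L‖ ≲ L⁻¹`, `‖D curl Ψ_L‖ ≲ L⁻²` on a ball of volume `∼ L³`), while the right-hand side is
`≥ M²μ{x₀} − M²μ(B̄(x₀, L R_K) ∖ {x₀})`; letting `L → 0`:

* `multiplier_measure_singleton_eq_zero` : **`μ {x₀} = 0` for every `x₀`** — the multiplier is atomless (for ANY smooth `v`
  with `‖v‖ ≡ M > 0` and any finite `μ` with the multiplier identity; no divergence-freeness or integrability of `v` is used).

READING.  In the strong Euler–Lagrange system `κ⋆²M²(ZΔ² − WΔ)V + S·N(V) = vμ + ∇p` an atom of `μ` would be a biharmonic point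
source (`V ∼ |x − x₀|` locally), incompatible with `V ∈ C²`; the quantitative form of the same computation would bound the upper
1-density `μ(B(x₀,r))/r` by the local size of `Dω` (record `Lines/extremiser_liouville_k1b_jet.md` §8).
WHAT THIS IS NOT: K1b is NOT proved; nothing here proves NS regularity. [folklore]
-/

noncomputable section

open Set Filter Topology MeasureTheory Metric Function
open scoped ENNReal NNReal Topology InnerProductSpace RealInnerProductSpace ContDiff
open Literature.Analysis.FluidPDE Literature.Analysis

namespace Summit.NavierStokesRegularity.NavierStokesRegularity.Theorems

-- the problem directory repeats the summit name (`NavierStokesRegularity/NavierStokesRegularity`)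
set_option linter.dupNamespace false

namespace ExtremiserLiouville

open DepletionLadder.KStar DepletionLadder.KStar.HalfSpace

variable {v : E3 → E3}

/-! ## The translated carrier `Ψ(x) = Φ_{b,L}(x − x₀)` -/

/-- Derivative of a translate: `D(g(· − x₀))(x) = Dg(x − x₀)` for `g` differentiable. [folklore] -/
theorem fderiv_comp_sub_const' {g : E3 → E3} (hg : Differentiable ℝ g) (x₀ x : E3) :
    fderiv ℝ (fun y => g (y - x₀)) x = fderiv ℝ g (x - x₀) := by
  have h : HasFDerivAt (fun y => g (y - x₀)) ((fderiv ℝ g (x - x₀)).comp (ContinuousLinearMap.id ℝ E3)) x :=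
    ((hg (x - x₀)).hasFDerivAt).comp x (hasFDerivAt_sub_const x₀)
  rw [h.fderiv, ContinuousLinearMap.comp_id]

/-- The translated carrier: smooth, compactly supported, solenoidal, `= b` at the centre, `‖·‖ ≤ ‖b‖`, zero off
`B̄(x₀, L·R_K)`, with `curl Ψ(x) = L⁻¹(curl Φ_b)((x − x₀)/L)`, `DΨ(x) = L⁻¹(DΦ_b)((x−x₀)/L)`,
`D curl Ψ(x) = L⁻²(D curl Φ_b)((x−x₀)/L)`. [folklore] -/
theorem translatedCarrier_props (b x₀ : E3) {L : ℝ} (hL : 0 < L) :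
    ContDiff ℝ ∞ (fun y => carrierAt b L (y - x₀)) ∧ HasCompactSupport (fun y => carrierAt b L (y - x₀)) ∧
      VectorCalculus.IsDivFree (fun y => carrierAt b L (y - x₀)) ∧ carrierAt b L (x₀ - x₀) = b ∧
      (∀ y, ‖carrierAt b L (y - x₀)‖ ≤ ‖b‖) ∧ (∀ y, L * suppRad < ‖y - x₀‖ → carrierAt b L (y - x₀) = 0) ∧
      (∀ y, curl (fun y => carrierAt b L (y - x₀)) y = L⁻¹ • curl (carrier b) (L⁻¹ • (y - x₀))) ∧
      (∀ y, fderiv ℝ (fun y => carrierAt b L (y - x₀)) y = L⁻¹ • fderiv ℝ (carrier b) (L⁻¹ • (y - x₀))) ∧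
      (∀ y, fderiv ℝ (curl fun y => carrierAt b L (y - x₀)) y = (L⁻¹ * L⁻¹) • fderiv ℝ (curl (carrier b)) (L⁻¹ • (y - x₀))) := by
  have hC : ContDiff ℝ ∞ (carrierAt b L) := contDiff_carrierAt b L
  have hd : Differentiable ℝ (carrierAt b L) := hC.differentiable (by simp)
  have hsmooth : ContDiff ℝ ∞ (fun y => carrierAt b L (y - x₀)) := hC.comp (contDiff_id.sub contDiff_const)
  have hD : ∀ y, fderiv ℝ (fun y => carrierAt b L (y - x₀)) y = fderiv ℝ (carrierAt b L) (y - x₀) :=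
    fderiv_comp_sub_const' hd x₀
  have hcurl : ∀ y, curl (fun y => carrierAt b L (y - x₀)) y = curl (carrierAt b L) (y - x₀) := fun y => by
    rw [curl_eq_curlCLM, curl_eq_curlCLM, hD]
  refine ⟨hsmooth, ?_, fun y => ?_, by rw [sub_self]; exact carrierAt_eq_of_norm_lt b hL (by rw [norm_zero]; exact hL),
    fun y => norm_carrierAt_le b hL _, fun y hy => carrierAt_eq_zero b hL hy, fun y => ?_, fun y => ?_, fun y => ?_⟩
  · refine HasCompactSupport.intro (isCompact_closedBall x₀ (L * suppRad)) fun y hy => ?_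
    rw [mem_closedBall, dist_eq_norm, not_le] at hy
    exact carrierAt_eq_zero b hL hy
  · simp only [VectorCalculus.divergence]
    rw [hD]
    exact isDivFree_carrierAt b L (y - x₀)
  · rw [hcurl, curl_carrierAt b hL]
  · rw [hD, fderiv_carrierAt b hL]
  · have e : curl (fun y => carrierAt b L (y - x₀)) = fun y => curl (carrierAt b L) (y - x₀) := funext hcurl
    have hdc : Differentiable ℝ (curl (carrierAt b L)) := (contDiff_curl (n := 1) (hC.of_le (by norm_cast))).differentiable one_ne_zero
    rw [e, fderiv_comp_sub_const' hdc x₀ y, fderiv_curl_carrierAt b hL]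

/-! ## The multiplier has no atoms -/

set_option maxHeartbeats 400000 in
/-- **The KKT multiplier of a residue object is atomless.**  Let `v` be smooth with `‖v‖ ≡ M > 0` and `μ` a finite measure with
`S·J₁(φ) − κ⋆²M²(W a₁(φ) + Z c₁(φ)) = ∫⟪v, φ⟫dμ` for all smooth compactly supported divergence-free `φ`.  Then `μ {x₀} = 0` for
every `x₀`. [folklore] -/
theorem multiplier_measure_singleton_eq_zero (hv : ContDiff ℝ ∞ v) {M : ℝ} (hMpos : 0 < M) (hM : ∀ x, ‖v x‖ = M)
    (μ : Measure E3) [IsFiniteMeasure μ]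
    (hμ : ∀ φ : E3 → E3, ContDiff ℝ ∞ φ → HasCompactSupport φ → VectorCalculus.IsDivFree φ →
      Jst v * J1 v φ - kStar ^ 2 * M ^ 2 * (Wpa v * A1 v φ + Zen v * C1 v φ) = ∫ x, ⟪v x, φ x⟫_ℝ ∂μ)
    (x₀ : E3) : μ {x₀} = 0 := by
  set b : E3 := v x₀ with hb
  have hbM : ‖b‖ = M := hM x₀
  set s : ℝ := suppRad with hs
  have hs0 : 0 < s := suppRad_pos
  -- local sup bounds of `curl v`, `Dv`, `D curl v` on `B̄(x₀, s)`
  have hcv : Continuous (curl v) := continuous_curl (hv.of_le (by norm_cast))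
  have hDv : Continuous (fderiv ℝ v) := hv.continuous_fderiv (by simp)
  have hDcv : Continuous (fderiv ℝ (curl v)) := (contDiff_curl (n := ⊤) (by exact_mod_cast hv)).continuous_fderiv (by simp)
  obtain ⟨Cω, hCω⟩ := (isCompact_closedBall x₀ s).exists_bound_of_continuousOn hcv.continuousOn
  obtain ⟨CD, hCD⟩ := (isCompact_closedBall x₀ s).exists_bound_of_continuousOn hDv.continuousOn
  obtain ⟨CDω, hCDω⟩ := (isCompact_closedBall x₀ s).exists_bound_of_continuousOn hDcv.continuousOn
  have hCω0 : 0 ≤ Cω := (norm_nonneg _).trans (hCω x₀ (mem_closedBall_self hs0.le))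
  have hCD0 : 0 ≤ CD := (norm_nonneg _).trans (hCD x₀ (mem_closedBall_self hs0.le))
  have hCDω0 : 0 ≤ CDω := (norm_nonneg _).trans (hCDω x₀ (mem_closedBall_self hs0.le))
  -- profile bounds of the unit carrier `Φ_b`
  have hcarC : ContDiff ℝ 2 (carrier b) := by
    unfold carrier; exact contDiff_curl (n := 2) ((contDiff_carrierPot b).of_le (by norm_cast))
  have hcarc : HasCompactSupport (carrier b) := by unfold carrier; exact hasCompactSupport_curl (hasCompactSupport_carrierPot b)
  obtain ⟨Cc, hCc0, -, hcurlc, hDc, hDcurlc⟩ := exists_bounds_of_profile hcarC hcarc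
  -- volume constant
  set v₁ : ℝ := (volume (ball (0 : E3) 1)).toReal with hv₁
  have hv₁0 : 0 ≤ v₁ := ENNReal.toReal_nonneg
  -- the constant of the `O(L)` bound
  have hZ0 : 0 ≤ Zen v := integral_nonneg fun x => sq_nonneg _
  have hW0 : 0 ≤ Wpa v := integral_nonneg fun x => frobeniusNormSq_nonneg _
  obtain ⟨K, hK⟩ : ∃ K : ℝ, K = (|Jst v| * (Cc * Cω * (2 * CD + Cω)) +
      kStar ^ 2 * M ^ 2 * (Wpa v * (Cω * Cc) + Zen v * (3 * CDω * Cc))) * (s ^ 3 * v₁) := ⟨_, rfl⟩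
  have hK0 : 0 ≤ K := by rw [hK]; positivity
  -- the key estimate for each `L ∈ (0, 1]`
  have key : ∀ L : ℝ, 0 < L → L ≤ 1 →
      M ^ 2 * μ.real {x₀} ≤ K * L + M ^ 2 * μ.real (closedBall x₀ (L * s) \ {x₀}) := by
    intro L hL hL1
    obtain ⟨hΨs, hΨc, hΨdiv, hΨ0, hΨb, hΨzero, hcurlΨ, hDΨ, hDcurlΨ⟩ := translatedCarrier_props b x₀ hL
    set Ψ : E3 → E3 := fun y => carrierAt b L (y - x₀) with hΨ
    have hid := hμ Ψ hΨs hΨc hΨdiv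
    set S : Set E3 := closedBall x₀ (L * s) with hSdef
    have hSm : MeasurableSet S := measurableSet_closedBall
    have hx₀S : x₀ ∈ S := mem_closedBall_self (by positivity)
    have hSsub : S ⊆ closedBall x₀ s := closedBall_subset_closedBall (by nlinarith)
    have hvolS : (volume S).toReal = (L * s) ^ 3 * v₁ := by
      rw [hSdef, Measure.addHaar_closedBall volume x₀ (by positivity : (0 : ℝ) ≤ L * s), finrank_euclideanSpace,
        Fintype.card_fin, ENNReal.toReal_mul, ENNReal.toReal_ofReal (by positivity)]
    -- the derivatives of `Ψ` vanish off `S`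
    have hoff : ∀ y, y ∉ S → curl Ψ y = 0 ∧ fderiv ℝ Ψ y = 0 ∧ fderiv ℝ (curl Ψ) y = 0 := by
      intro y hy
      rw [hSdef, mem_closedBall, dist_eq_norm, not_le] at hy
      have hev : Ψ =ᶠ[𝓝 y] fun _ => (0 : E3) := by
        have hopen : IsOpen {z : E3 | L * s < ‖z - x₀‖} := isOpen_lt continuous_const (continuous_id.sub continuous_const).norm
        filter_upwards [hopen.mem_nhds hy] with z hz
        exact hΨzero z hz
      have hD0 : fderiv ℝ Ψ y = 0 := by rw [hev.fderiv_eq]; simp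
      have hc0 : curl Ψ y = 0 := by rw [curl_eq_curlCLM, hD0, map_zero]
      have hevc : curl Ψ =ᶠ[𝓝 y] fun _ => (0 : E3) := by
        have hopen : IsOpen {z : E3 | L * s < ‖z - x₀‖} := isOpen_lt continuous_const (continuous_id.sub continuous_const).norm
        filter_upwards [hopen.mem_nhds hy] with z hz
        have hevz : Ψ =ᶠ[𝓝 z] fun _ => (0 : E3) := by
          filter_upwards [hopen.mem_nhds hz] with u hu
          exact hΨzero u hu
        rw [curl_eq_curlCLM, hevz.fderiv_eq]
        simp
      exact ⟨hc0, hD0, by rw [hevc.fderiv_eq]; simp⟩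
    -- pointwise bounds of the three densities by constants times the indicator of `S`
    have hA : |A1 v Ψ| ≤ Cω * (L⁻¹ * Cc) * ((L * s) ^ 3 * v₁) := by
      unfold A1
      have hpt : ∀ y, |⟪curl v y, curl Ψ y⟫_ℝ| ≤ S.indicator (fun _ => Cω * (L⁻¹ * Cc)) y := by
        intro y
        by_cases hy : y ∈ S
        · rw [indicator_of_mem hy]
          refine (abs_real_inner_le_norm _ _).trans (mul_le_mul (hCω y (hSsub hy)) ?_ (norm_nonneg _) hCω0)
          rw [hcurlΨ, norm_smul, Real.norm_eq_abs, abs_of_pos (inv_pos.2 hL)]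
          exact mul_le_mul_of_nonneg_left (hcurlc _) (inv_pos.2 hL).le
        · rw [indicator_of_notMem hy, (hoff y hy).1, inner_zero_right, abs_zero]
      have hint : Integrable (S.indicator fun _ => Cω * (L⁻¹ * Cc)) volume := by
        rw [integrable_indicator_iff hSm]; exact integrableOn_const measure_closedBall_lt_top.ne
      refine (abs_integral_le_integral_abs).trans ((integral_mono_of_nonneg (Eventually.of_forall fun y => abs_nonneg _) hint
        (Eventually.of_forall hpt)).trans (le_of_eq ?_))
      rw [integral_indicator hSm, setIntegral_const, smul_eq_mul, Measure.real, hvolS, mul_comm]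
    have hC : |C1 v Ψ| ≤ 3 * CDω * (L⁻¹ * L⁻¹ * Cc) * ((L * s) ^ 3 * v₁) := by
      unfold C1
      have hpt : ∀ y, |∑ i, ⟪fderiv ℝ (curl v) y (EuclideanSpace.basisFun (Fin 3) ℝ i),
          fderiv ℝ (curl Ψ) y (EuclideanSpace.basisFun (Fin 3) ℝ i)⟫_ℝ| ≤ S.indicator (fun _ => 3 * CDω * (L⁻¹ * L⁻¹ * Cc)) y := by
        intro y
        by_cases hy : y ∈ S
        · rw [indicator_of_mem hy]
          have hn : ‖fderiv ℝ (curl Ψ) y‖ ≤ L⁻¹ * L⁻¹ * Cc := by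
            rw [hDcurlΨ, norm_smul, Real.norm_eq_abs, abs_of_pos (by positivity)]
            exact mul_le_mul_of_nonneg_left (hDcurlc _) (by positivity)
          refine (Finset.abs_sum_le_sum_abs _ _).trans ?_
          have hterm : ∀ i : Fin 3, |⟪fderiv ℝ (curl v) y (EuclideanSpace.basisFun (Fin 3) ℝ i),
              fderiv ℝ (curl Ψ) y (EuclideanSpace.basisFun (Fin 3) ℝ i)⟫_ℝ| ≤ CDω * (L⁻¹ * L⁻¹ * Cc) := by
            intro i
            have h1 : ‖fderiv ℝ (curl v) y (EuclideanSpace.basisFun (Fin 3) ℝ i)‖ ≤ CDω := by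
              refine ((fderiv ℝ (curl v) y).le_opNorm _).trans ?_
              rw [EuclideanSpace.basisFun_apply, PiLp.norm_single, norm_one, mul_one]; exact hCDω y (hSsub hy)
            have h2 : ‖fderiv ℝ (curl Ψ) y (EuclideanSpace.basisFun (Fin 3) ℝ i)‖ ≤ L⁻¹ * L⁻¹ * Cc := by
              refine ((fderiv ℝ (curl Ψ) y).le_opNorm _).trans ?_
              rw [EuclideanSpace.basisFun_apply, PiLp.norm_single, norm_one, mul_one]; exact hn
            exact (abs_real_inner_le_norm _ _).trans (mul_le_mul h1 h2 (norm_nonneg _) hCDω0)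
          calc ∑ i, |⟪fderiv ℝ (curl v) y (EuclideanSpace.basisFun (Fin 3) ℝ i),
                fderiv ℝ (curl Ψ) y (EuclideanSpace.basisFun (Fin 3) ℝ i)⟫_ℝ|
              ≤ ∑ _i : Fin 3, CDω * (L⁻¹ * L⁻¹ * Cc) := Finset.sum_le_sum fun i _ => hterm i
            _ = 3 * CDω * (L⁻¹ * L⁻¹ * Cc) := by rw [Finset.sum_const, Finset.card_univ, Fintype.card_fin]; ring
        · rw [indicator_of_notMem hy, (hoff y hy).2.2]
          simp
      have hint : Integrable (S.indicator fun _ => 3 * CDω * (L⁻¹ * L⁻¹ * Cc)) volume := by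
        rw [integrable_indicator_iff hSm]; exact integrableOn_const measure_closedBall_lt_top.ne
      refine (abs_integral_le_integral_abs).trans ((integral_mono_of_nonneg (Eventually.of_forall fun y => abs_nonneg _) hint
        (Eventually.of_forall hpt)).trans (le_of_eq ?_))
      rw [integral_indicator hSm, setIntegral_const, smul_eq_mul, Measure.real, hvolS, mul_comm]
    have hJ : |J1 v Ψ| ≤ Cc * Cω * (2 * CD + Cω) * L⁻¹ * ((L * s) ^ 3 * v₁) := by
      unfold J1
      have hpt : ∀ y, |⟪curl Ψ y, fderiv ℝ v y (curl v y)⟫_ℝ + ⟪curl v y, fderiv ℝ Ψ y (curl v y)⟫_ℝ +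
          ⟪curl v y, fderiv ℝ v y (curl Ψ y)⟫_ℝ| ≤ S.indicator (fun _ => Cc * Cω * (2 * CD + Cω) * L⁻¹) y := by
        intro y
        by_cases hy : y ∈ S
        · rw [indicator_of_mem hy]
          have hcΨ : ‖curl Ψ y‖ ≤ L⁻¹ * Cc := by
            rw [hcurlΨ, norm_smul, Real.norm_eq_abs, abs_of_pos (inv_pos.2 hL)]
            exact mul_le_mul_of_nonneg_left (hcurlc _) (inv_pos.2 hL).le
          have hDΨy : ‖fderiv ℝ Ψ y‖ ≤ L⁻¹ * Cc := by
            rw [hDΨ, norm_smul, Real.norm_eq_abs, abs_of_pos (inv_pos.2 hL)]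
            exact mul_le_mul_of_nonneg_left (hDc _) (inv_pos.2 hL).le
          have hω := hCω y (hSsub hy)
          have hDvy := hCD y (hSsub hy)
          have t1 : |⟪curl Ψ y, fderiv ℝ v y (curl v y)⟫_ℝ| ≤ (L⁻¹ * Cc) * (CD * Cω) := by
            refine (abs_real_inner_le_norm _ _).trans (mul_le_mul hcΨ ?_ (norm_nonneg _) (by positivity))
            exact ((fderiv ℝ v y).le_opNorm _).trans (mul_le_mul hDvy hω (norm_nonneg _) hCD0)
          have t2 : |⟪curl v y, fderiv ℝ Ψ y (curl v y)⟫_ℝ| ≤ Cω * ((L⁻¹ * Cc) * Cω) := by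
            refine (abs_real_inner_le_norm _ _).trans (mul_le_mul hω ?_ (norm_nonneg _) hCω0)
            exact ((fderiv ℝ Ψ y).le_opNorm _).trans (mul_le_mul hDΨy hω (norm_nonneg _) (by positivity))
          have t3 : |⟪curl v y, fderiv ℝ v y (curl Ψ y)⟫_ℝ| ≤ Cω * (CD * (L⁻¹ * Cc)) := by
            refine (abs_real_inner_le_norm _ _).trans (mul_le_mul hω ?_ (norm_nonneg _) hCω0)
            exact ((fderiv ℝ v y).le_opNorm _).trans (mul_le_mul hDvy hcΨ (norm_nonneg _) hCD0)
          calc _ ≤ (L⁻¹ * Cc) * (CD * Cω) + Cω * ((L⁻¹ * Cc) * Cω) + Cω * (CD * (L⁻¹ * Cc)) :=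
                (abs_add_le _ _).trans (add_le_add ((abs_add_le _ _).trans (add_le_add t1 t2)) t3)
            _ = Cc * Cω * (2 * CD + Cω) * L⁻¹ := by ring
        · rw [indicator_of_notMem hy, (hoff y hy).1, (hoff y hy).2.1]
          simp
      have hint : Integrable (S.indicator fun _ => Cc * Cω * (2 * CD + Cω) * L⁻¹) volume := by
        rw [integrable_indicator_iff hSm]; exact integrableOn_const measure_closedBall_lt_top.ne
      refine (abs_integral_le_integral_abs).trans ((integral_mono_of_nonneg (Eventually.of_forall fun y => abs_nonneg _) hint
        (Eventually.of_forall hpt)).trans (le_of_eq ?_))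
      rw [integral_indicator hSm, setIntegral_const, smul_eq_mul, Measure.real, hvolS, mul_comm]
    -- the left-hand side is `≤ K L`
    have hLHS : |Jst v * J1 v Ψ - kStar ^ 2 * M ^ 2 * (Wpa v * A1 v Ψ + Zen v * C1 v Ψ)| ≤ K * L := by
      have e1 : Cc * Cω * (2 * CD + Cω) * L⁻¹ * ((L * s) ^ 3 * v₁) = Cc * Cω * (2 * CD + Cω) * (s ^ 3 * v₁) * L ^ 2 := by
        field_simp
      have e2 : Cω * (L⁻¹ * Cc) * ((L * s) ^ 3 * v₁) = Cω * Cc * (s ^ 3 * v₁) * L ^ 2 := by field_simp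
      have e3 : 3 * CDω * (L⁻¹ * L⁻¹ * Cc) * ((L * s) ^ 3 * v₁) = 3 * CDω * Cc * (s ^ 3 * v₁) * L := by field_simp
      rw [e1] at hJ; rw [e2] at hA; rw [e3] at hC
      have hL2 : L ^ 2 ≤ L := by nlinarith
      have hJ' : |Jst v * J1 v Ψ| ≤ |Jst v| * (Cc * Cω * (2 * CD + Cω) * (s ^ 3 * v₁)) * L := by
        rw [abs_mul]
        calc |Jst v| * |J1 v Ψ| ≤ |Jst v| * (Cc * Cω * (2 * CD + Cω) * (s ^ 3 * v₁) * L ^ 2) :=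
              mul_le_mul_of_nonneg_left hJ (abs_nonneg _)
          _ ≤ |Jst v| * (Cc * Cω * (2 * CD + Cω) * (s ^ 3 * v₁) * L) := by
              refine mul_le_mul_of_nonneg_left (mul_le_mul_of_nonneg_left hL2 (by positivity)) (abs_nonneg _)
          _ = _ := by ring
      have hA' : |Wpa v * A1 v Ψ| ≤ Wpa v * (Cω * Cc * (s ^ 3 * v₁)) * L := by
        rw [abs_mul, abs_of_nonneg hW0]
        calc Wpa v * |A1 v Ψ| ≤ Wpa v * (Cω * Cc * (s ^ 3 * v₁) * L ^ 2) := mul_le_mul_of_nonneg_left hA hW0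
          _ ≤ Wpa v * (Cω * Cc * (s ^ 3 * v₁) * L) :=
              mul_le_mul_of_nonneg_left (mul_le_mul_of_nonneg_left hL2 (by positivity)) hW0
          _ = _ := by ring
      have hC' : |Zen v * C1 v Ψ| ≤ Zen v * (3 * CDω * Cc * (s ^ 3 * v₁)) * L := by
        rw [abs_mul, abs_of_nonneg hZ0]
        calc Zen v * |C1 v Ψ| ≤ Zen v * (3 * CDω * Cc * (s ^ 3 * v₁) * L) := mul_le_mul_of_nonneg_left hC hZ0
          _ = _ := by ring
      have hk2 : 0 ≤ kStar ^ 2 * M ^ 2 := by positivity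
      calc |Jst v * J1 v Ψ - kStar ^ 2 * M ^ 2 * (Wpa v * A1 v Ψ + Zen v * C1 v Ψ)|
          ≤ |Jst v * J1 v Ψ| + kStar ^ 2 * M ^ 2 * (|Wpa v * A1 v Ψ| + |Zen v * C1 v Ψ|) := by
            refine (abs_sub _ _).trans (add_le_add le_rfl ?_)
            rw [abs_mul, abs_of_nonneg hk2]
            exact mul_le_mul_of_nonneg_left (abs_add_le _ _) hk2
        _ ≤ |Jst v| * (Cc * Cω * (2 * CD + Cω) * (s ^ 3 * v₁)) * L +
            kStar ^ 2 * M ^ 2 * (Wpa v * (Cω * Cc * (s ^ 3 * v₁)) * L + Zen v * (3 * CDω * Cc * (s ^ 3 * v₁)) * L) :=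
            add_le_add hJ' (mul_le_mul_of_nonneg_left (add_le_add hA' hC') hk2)
        _ = K * L := by rw [hK]; ring
    -- the right-hand side is `≥ M² μ{x₀} − M² μ(S ∖ {x₀})`
    have hf_int : Integrable (fun x => ⟪v x, Ψ x⟫_ℝ) μ := by
      refine (integrable_const (M * M)).mono' (hv.continuous.inner hΨs.continuous).aestronglyMeasurable
        (Eventually.of_forall fun x => ?_)
      rw [Real.norm_eq_abs]
      refine (abs_real_inner_le_norm _ _).trans ?_
      rw [hM x]; exact mul_le_mul_of_nonneg_left ((hΨb x).trans hbM.le) hMpos.le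
    have hf_zero : ∀ x, x ∉ S → ⟪v x, Ψ x⟫_ℝ = 0 := fun x hx => by
      rw [hSdef, mem_closedBall, dist_eq_norm, not_le] at hx
      show ⟪v x, carrierAt b L (x - x₀)⟫_ℝ = 0
      rw [hΨzero x hx, inner_zero_right]
    have hRHS : M ^ 2 * μ.real {x₀} - M ^ 2 * μ.real (S \ {x₀}) ≤ ∫ x, ⟪v x, Ψ x⟫_ℝ ∂μ := by
      have hS : (∫ x, ⟪v x, Ψ x⟫_ℝ ∂μ) = ∫ x in S, ⟪v x, Ψ x⟫_ℝ ∂μ := by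
        rw [← integral_indicator hSm]
        refine integral_congr_ae (Eventually.of_forall fun x => ?_)
        by_cases hx : x ∈ S
        · rw [indicator_of_mem hx]
        · rw [indicator_of_notMem hx]; exact hf_zero x hx
      rw [hS, ← integral_inter_add_sdiff (measurableSet_singleton x₀) hf_int.integrableOn,
        inter_eq_right.2 (singleton_subset_iff.2 hx₀S), integral_singleton, smul_eq_mul]
      have h0 : ⟪v x₀, Ψ x₀⟫_ℝ = M ^ 2 := by
        show ⟪v x₀, carrierAt b L (x₀ - x₀)⟫_ℝ = M ^ 2
        rw [hΨ0, hb, real_inner_self_eq_norm_sq, hM x₀]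
      rw [h0]
      have hrest : |∫ x in S \ {x₀}, ⟪v x, Ψ x⟫_ℝ ∂μ| ≤ M ^ 2 * μ.real (S \ {x₀}) := by
        have h := norm_setIntegral_le_of_norm_le_const (measure_lt_top μ (S \ {x₀}))
          (fun x _ => show ‖⟪v x, Ψ x⟫_ℝ‖ ≤ M ^ 2 from by
            rw [Real.norm_eq_abs]
            refine (abs_real_inner_le_norm _ _).trans ?_
            rw [hM x, sq]; exact mul_le_mul_of_nonneg_left ((hΨb x).trans hbM.le) hMpos.le)
        rw [Real.norm_eq_abs] at h
        linarith [h]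
      have h1 := (abs_le.1 hrest).1
      rw [mul_comm (μ.real {x₀})]
      linarith [h1]
    have := (le_abs_self _).trans hLHS
    rw [hid] at this
    linarith
  -- the annuli `B̄(x₀, s/(n+1)) ∖ {x₀}` shrink to `∅`
  have hlim : Tendsto (fun n : ℕ => μ.real (closedBall x₀ ((1 / ((n : ℝ) + 1)) * s) \ {x₀})) atTop (𝓝 0) := by
    have hmeas : Tendsto (fun n : ℕ => μ (closedBall x₀ ((1 / ((n : ℝ) + 1)) * s) \ {x₀})) atTop
        (𝓝 (μ (⋂ n : ℕ, (closedBall x₀ ((1 / ((n : ℝ) + 1)) * s) \ {x₀})))) := by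
      refine tendsto_measure_iInter_atTop (fun n => (measurableSet_closedBall.diff (measurableSet_singleton _)).nullMeasurableSet)
        ?_ ⟨0, measure_ne_top μ _⟩
      intro m n hmn
      refine sdiff_subset_sdiff_left (closedBall_subset_closedBall (mul_le_mul_of_nonneg_right ?_ hs0.le))
      exact one_div_le_one_div_of_le (by positivity) (by exact_mod_cast Nat.succ_le_succ hmn |>.trans (by simp))
    have hempty : (⋂ n : ℕ, (closedBall x₀ ((1 / ((n : ℝ) + 1)) * s) \ {x₀})) = ∅ := by
      refine eq_empty_iff_forall_notMem.2 fun y hy => ?_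
      rw [mem_iInter] at hy
      have hy0 : y ≠ x₀ := fun h => (hy 0).2 h
      have hpos : 0 < dist y x₀ := dist_pos.2 hy0
      obtain ⟨n, hn⟩ := exists_nat_gt (s / dist y x₀)
      have h := (hy n).1
      rw [mem_closedBall] at h
      have h' : dist y x₀ ≤ s / ((n : ℝ) + 1) := by rwa [one_div, inv_mul_eq_div] at h
      rw [le_div_iff₀ (by positivity)] at h'
      rw [div_lt_iff₀ hpos] at hn
      nlinarith
    rw [hempty, measure_empty] at hmeas
    exact (ENNReal.tendsto_toReal ENNReal.zero_ne_top).comp hmeas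
  -- conclude
  have hfinal : M ^ 2 * μ.real {x₀} ≤ 0 := by
    have h1 : Tendsto (fun n : ℕ => K * (1 / ((n : ℝ) + 1))) atTop (𝓝 (K * 0)) :=
      tendsto_one_div_add_atTop_nhds_zero_nat.const_mul K
    rw [mul_zero] at h1
    have h2 := hlim.const_mul (M ^ 2)
    rw [mul_zero] at h2
    have h := h1.add h2
    rw [add_zero] at h
    refine le_of_tendsto_of_tendsto' (tendsto_const_nhds (x := M ^ 2 * μ.real {x₀}) (f := (atTop : Filter ℕ))) h
      (fun n : ℕ => key (1 / ((n : ℝ) + 1)) (by positivity) ?_)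
    rw [div_le_one (by positivity)]; linarith
  have hμ0 : μ.real {x₀} ≤ 0 := by
    by_contra h
    have : 0 < μ.real {x₀} := lt_of_not_ge h
    nlinarith [pow_pos hMpos 2]
  have hμ0' : μ.real {x₀} = 0 := le_antisymm hμ0 measureReal_nonneg
  exact (measureReal_eq_zero_iff (measure_ne_top μ _)).1 hμ0'

end ExtremiserLiouville

end Summit.NavierStokesRegularity.NavierStokesRegularity.Theorems

end
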